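import Mathlib
import Summits.Ventures.PercRepro2.OneEdge
import Summits.Ventures.PercRepro2.OneTypedEdge
import Summits.Ventures.PercRepro2.TypedSplit
import Summits.Ventures.PercRepro2.TypedUntouched
import Summits.Ventures.PercRepro2.TypedSwapRoots
import Summits.Ventures.PercRepro2.TypedCoincRootEdge

/-!
# The coincident mark `b = a₃` with a root edge of type 1 whose root is cut off from `o` and `b`:
every typed base vanishes (blind cell PercRepro2, night-3 g14, 2026-08-27; `proofs/NIGHT3-CERT.md`
§23)

For the coincident marking `b = a₃` let `e = {a₁, a₃}` be a typed edge of type `1` (open in exactly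
one copy) such that, with `e` closed, `a₁` is joined to neither `o` nor `a₃` (`hiso`: every
configuration with `e` closed has `a₁ ↮ o` and `a₁ ↮ a₃` — e.g. `a₁` a leaf at `b = a₃`, or the
component of `a₁` in the graph without `e` free of `o` and `a₃`).  Then every typed base vanishes
(`typedCount_eq_zero_of_coinc_root_leaf_one`; with `TypedCoincRootEdge` for type `2`:
`typedCount_eq_zero_of_coinc_root_leaf`; mirrors at `a₂`).

Mechanism (a single-edge signature identity): six times the base is the typed count of the
symmetrised kernel on states; splitting the count at `e` (`typedCount_split`) leaves the three
placements of the open copy; with `e` closed the state of every copy is `mkSt q false false false H_o H_b H_b`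
(`L`-part empty), and opening `e` either kills `Q` (`a₃ ∈ C(a₂)` or `a₁ ~ a₂` already) or produces
`mkSt false L_o' true true H_o false false` with `L_o' = [o ~ a₃]` (`conn_update_true_iff`); the
three-term sum of the symmetrised kernel over these models vanishes on all 4,096 signature triples
(`block_identity`, `decide`).  Without the isolation hypothesis the identity fails (3,150 of 110,592
general triples, `mining/night-3/g14/r9state.py`), and the type-1 rule is false (random census
`census_r8.py`).  On the ∣F∣ = 9 domain of record the rule explains 354 of the 650
identically-vanishing instances left by the degree-2 mark rules.  Nothing here asserts anything
about the original lane.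
-/

namespace Summit.Ventures.PercRepro2

open UnionCluster

namespace CovForm

namespace CoincRoot

open OneTyped Untouched TypedA3 TypedRed

/-! ## The signature models and the block identity -/

section States

/-- **The single-edge block identity** (4,096 signature triples): the symmetrised kernel summed over
the three placements of the open copy vanishes.  The state of a copy with the root edge closed and
`a₁` cut off from `o` and `a₃` is `mkSt q false false false H_o H_b H_b`; with the edge open it is
`mkSt true …` (`Q` fails: `a₃ ∈ C(a₂)` or `a₁ ~ a₂` already) or `mkSt false L_o' true true H_o false
false` (`a₃ = b` joins `C(a₁)`, together with `o` when `o ~ a₃`). -/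
theorem block_identity (qx Hox Hbx Lx qy Hoy Hby Ly qw How Hbw Lw : Bool) :
    KBsym (if qx || Hbx then mkSt true false false false false false false else mkSt false Lx true true Hox false false) (mkSt qy false false false Hoy Hby Hby) (mkSt qw false false false How Hbw Hbw) +
      KBsym (mkSt qx false false false Hox Hbx Hbx) (if qy || Hby then mkSt true false false false false false false else mkSt false Ly true true Hoy false false) (mkSt qw false false false How Hbw Hbw) +
      KBsym (mkSt qx false false false Hox Hbx Hbx) (mkSt qy false false false Hoy Hby Hby) (if qw || Hbw then mkSt true false false false false false false else mkSt false Lw true true How false false) = 0 := by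
  revert qx Hox Hbx Lx qy Hoy Hby Ly qw How Hbw Lw
  decide +kernel

/-- A first-argument congruence of the symmetrised kernel transported to the second argument. -/
lemma KBsym_eq_of_pos2 {x x' : St} (h : ∀ A B, KBsym x A B = KBsym x' A B) (A B : St) :
    KBsym A x B = KBsym A x' B := by
  rw [KBsym_comm_left, h, KBsym_comm_left]

/-- A first-argument congruence of the symmetrised kernel transported to the third argument. -/
lemma KBsym_eq_of_pos3 {x x' : St} (h : ∀ A B, KBsym x A B = KBsym x' A B) (A B : St) :
    KBsym A B x = KBsym A B x' := by
  rw [KBsym_comm_right, KBsym_comm_left, h, KBsym_comm_left, KBsym_comm_right]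

end States

/-! ## The states of the configurations -/

section Graph

open Classical

variable {V : Type*} {E : Type*} [Fintype E] [DecidableEq E]
variable (ends : E → Sym2 V) (o a₁ a₂ a₃ : V)

omit [Fintype E] [DecidableEq E] in
/-- With the root edge closed and `a₁` cut off from `o` and `a₃`, the state has an empty `L`-part. -/
lemma st_eq_rs (x : Config E) (ho : ¬ Conn ends x a₁ o) (h3 : ¬ Conn ends x a₁ a₃) :
    st ends o a₁ a₂ a₃ a₃ x =
      mkSt (decide (Conn ends x a₂ a₁)) false false false (decide (Conn ends x a₂ o))
        (decide (Conn ends x a₂ a₃)) (decide (Conn ends x a₂ a₃)) := by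
  unfold st mkSt
  simp only [ho, h3, decide_false]

omit [Fintype E] in
/-- Opening the root edge `e = {a₁, a₃}`: the symmetrised kernel reads the state of the opened copy
through its model (either both states fail `Q`, or they coincide). -/
lemma KBsym_st_update_eq {e : E} (he : ends e = s(a₁, a₃)) (x : Config E)
    (ho : ¬ Conn ends x a₁ o) (h3 : ¬ Conn ends x a₁ a₃) (A B : St) :
    KBsym (st ends o a₁ a₂ a₃ a₃ (Function.update x e true)) A B =
      KBsym (if decide (Conn ends x a₂ a₁) || decide (Conn ends x a₂ a₃) then
          mkSt true false false false false false false
        else mkSt false (decide (Conn ends x a₃ o)) true true (decide (Conn ends x a₂ o)) false false)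
        A B := by
  have hiff : ∀ s v, Conn ends (Function.update x e true) s v ↔
      Conn ends x s v ∨ (Conn ends x s a₁ ∧ Conn ends x a₃ v) ∨ (Conn ends x s a₃ ∧ Conn ends x a₁ v) :=
    fun s v => OneEdge.conn_update_true_iff he x s v
  by_cases hfail : Conn ends x a₂ a₁ ∨ Conn ends x a₂ a₃
  · -- both states fail `Q`
    have h1 : (st ends o a₁ a₂ a₃ a₃ (Function.update x e true)).q' = true := by
      unfold st St.q'
      apply decide_eq_true
      rw [hiff]
      rcases hfail with h | h
      · exact Or.inl h
      · exact Or.inr (Or.inr ⟨h, conn_refl ends x a₁⟩)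
    have h2 : (if decide (Conn ends x a₂ a₁) || decide (Conn ends x a₂ a₃) then
          mkSt true false false false false false false
        else mkSt false (decide (Conn ends x a₃ o)) true true (decide (Conn ends x a₂ o)) false
          false).q' = true := by
      have : (decide (Conn ends x a₂ a₁) || decide (Conn ends x a₂ a₃)) = true := by
        rcases hfail with h | h <;> simp [h]
      rw [if_pos this]
      rfl
    rw [KBsym_eq_zero_of_q' _ _ _ (Or.inl h1), KBsym_eq_zero_of_q' _ _ _ (Or.inl h2)]
  · -- the states coincide
    rw [not_or] at hfail
    obtain ⟨hq, hb⟩ := hfail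
    congr 1
    rw [if_neg (by simp [hq, hb])]
    unfold st mkSt
    have e1 : Conn ends (Function.update x e true) a₂ a₁ ↔ False := by
      rw [hiff]
      constructor
      · rintro (h | ⟨h, _⟩ | ⟨h, _⟩)
        · exact hq h
        · exact hq h
        · exact hb h
      · exact False.elim
    have e2 : Conn ends (Function.update x e true) a₁ o ↔ Conn ends x a₃ o := by
      rw [hiff]
      constructor
      · rintro (h | ⟨_, h⟩ | ⟨h, _⟩)
        · exact absurd h ho
        · exact h
        · exact absurd h h3
      · intro h
        exact Or.inr (Or.inl ⟨conn_refl ends x a₁, h⟩)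
    have e3 : Conn ends (Function.update x e true) a₂ o ↔ Conn ends x a₂ o := by
      rw [hiff]
      constructor
      · rintro (h | ⟨h, _⟩ | ⟨h, _⟩)
        · exact h
        · exact absurd h hq
        · exact absurd h hb
      · exact fun h => Or.inl h
    have e4 : Conn ends (Function.update x e true) a₁ a₃ ↔ True := by
      rw [hiff]
      simp only [iff_true]
      exact Or.inr (Or.inl ⟨conn_refl ends x a₁, conn_refl ends x a₃⟩)
    have e5 : Conn ends (Function.update x e true) a₂ a₃ ↔ False := by
      rw [hiff]
      constructor
      · rintro (h | ⟨h, _⟩ | ⟨h, _⟩)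
        · exact hb h
        · exact hq h
        · exact hb h
      · exact False.elim
    simp only [e1, e2, e3, e4, e5, decide_true, decide_false]

end Graph

/-! ## The theorem -/

section Main

open Classical

variable {V : Type*} {E : Type*} [Fintype E] [DecidableEq E] {R : Type*} [Field R]
  [LinearOrder R] [IsStrictOrderedRing R]
variable (ends : E → Sym2 V) (o a₁ a₂ a₃ : V)

omit [LinearOrder R] [IsStrictOrderedRing R] in
/-- Six times the typed base, as the typed count of the symmetrised kernel on states. -/
lemma six_mul_typedCount_KBsym' (F : Finset E) (z : Config E) (τ : E → ℕ)
    (hτ : ∀ e ∈ F, τ e = 1 ∨ τ e = 2) :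
    6 * typedCount F z τ (K3 ends o a₁ a₂ a₃ a₃ : Config E → Config E → Config E → R) =
      typedCount F z τ (fun x y w => ((KBsym (st ends o a₁ a₂ a₃ a₃ x) (st ends o a₁ a₂ a₃ a₃ y)
        (st ends o a₁ a₂ a₃ a₃ w) : ℤ) : R)) := by
  rw [six_mul_typedCount F z τ hτ]
  refine typedCount_congr_K F z τ fun x y w => ?_
  simp only [K3_eq_KB ends o a₁ a₂ a₃ a₃]
  unfold KBsym
  push_cast
  ring_nf

/-- **The coincident marking `b = a₃`, a root edge `e = {a₁, a₃}` of type 1 with `a₁` cut off from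
`o` and `a₃` when `e` is closed: every typed base vanishes.** -/
theorem typedCount_eq_zero_of_coinc_root_leaf_one {e : E} (he : ends e = s(a₁, a₃))
    (hiso : ∀ x : Config E, x e = false → ¬ Conn ends x a₁ o ∧ ¬ Conn ends x a₁ a₃)
    (F : Finset E) (heF : e ∈ F) (z : Config E) (τ : E → ℕ) (hτ : ∀ e ∈ F, τ e = 1 ∨ τ e = 2)
    (hτe : τ e = 1) :
    typedCount F z τ (K3 ends o a₁ a₂ a₃ a₃ : Config E → Config E → Config E → R) = 0 := by
  have h6 := six_mul_typedCount_KBsym' (R := R) ends o a₁ a₂ a₃ F z τ hτ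
  have hK : typedCount F z τ (fun x y w => ((KBsym (st ends o a₁ a₂ a₃ a₃ x) (st ends o a₁ a₂ a₃ a₃ y)
      (st ends o a₁ a₂ a₃ a₃ w) : ℤ) : R)) = 0 := by
    rw [typedCount_split F e heF z τ]
    simp only [Fintype.sum_bool, Bool.toNat_true, Bool.toNat_false, hτe]
    norm_num
    rw [← typedCount_add, ← typedCount_add,
      ← typedCount_zero_kernel (F.erase e) (Function.update z e false) τ]
    refine typedCount_congr_on_support _ _ τ fun x y w hxyw _ => ?_
    have hx : x e = false := by
      have := (hxyw e (Finset.notMem_erase e F)).1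
      rw [this, Function.update_self]
    have hy : y e = false := by
      have := (hxyw e (Finset.notMem_erase e F)).2.1
      rw [this, Function.update_self]
    have hw : w e = false := by
      have := (hxyw e (Finset.notMem_erase e F)).2.2
      rw [this, Function.update_self]
    have ux : Function.update x e false = x := by rw [← hx]; exact Function.update_eq_self e x
    have uy : Function.update y e false = y := by rw [← hy]; exact Function.update_eq_self e y
    have uw : Function.update w e false = w := by rw [← hw]; exact Function.update_eq_self e w
    rw [ux, uy, uw]
    obtain ⟨hxo, hx3⟩ := hiso x hx
    obtain ⟨hyo, hy3⟩ := hiso y hy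
    obtain ⟨hwo, hw3⟩ := hiso w hw
    -- read the opened copies through their models
    have kx := KBsym_st_update_eq ends o a₁ a₂ a₃ he x hxo hx3
    have ky := KBsym_st_update_eq ends o a₁ a₂ a₃ he y hyo hy3
    have kw := KBsym_st_update_eq ends o a₁ a₂ a₃ he w hwo hw3
    rw [KBsym_eq_of_pos3 kw, KBsym_eq_of_pos2 ky, kx]
    rw [st_eq_rs ends o a₁ a₂ a₃ x hxo hx3, st_eq_rs ends o a₁ a₂ a₃ y hyo hy3,
      st_eq_rs ends o a₁ a₂ a₃ w hwo hw3]
    have hb := block_identity (decide (Conn ends x a₂ a₁)) (decide (Conn ends x a₂ o))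
      (decide (Conn ends x a₂ a₃)) (decide (Conn ends x a₃ o))
      (decide (Conn ends y a₂ a₁)) (decide (Conn ends y a₂ o)) (decide (Conn ends y a₂ a₃))
      (decide (Conn ends y a₃ o))
      (decide (Conn ends w a₂ a₁)) (decide (Conn ends w a₂ o)) (decide (Conn ends w a₂ a₃))
      (decide (Conn ends w a₃ o))
    have hb' : ((KBsym (if decide (Conn ends x a₂ a₁) || decide (Conn ends x a₂ a₃) then mkSt true false false false false false false else mkSt false (decide (Conn ends x a₃ o)) true true (decide (Conn ends x a₂ o)) false false) (mkSt (decide (Conn ends y a₂ a₁)) false false false (decide (Conn ends y a₂ o)) (decide (Conn ends y a₂ a₃)) (decide (Conn ends y a₂ a₃))) (mkSt (decide (Conn ends w a₂ a₁)) false false false (decide (Conn ends w a₂ o)) (decide (Conn ends w a₂ a₃)) (decide (Conn ends w a₂ a₃))) : ℤ) : R) +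
      ((KBsym (mkSt (decide (Conn ends x a₂ a₁)) false false false (decide (Conn ends x a₂ o)) (decide (Conn ends x a₂ a₃)) (decide (Conn ends x a₂ a₃))) (if decide (Conn ends y a₂ a₁) || decide (Conn ends y a₂ a₃) then mkSt true false false false false false false else mkSt false (decide (Conn ends y a₃ o)) true true (decide (Conn ends y a₂ o)) false false) (mkSt (decide (Conn ends w a₂ a₁)) false false false (decide (Conn ends w a₂ o)) (decide (Conn ends w a₂ a₃)) (decide (Conn ends w a₂ a₃))) : ℤ) : R) +
      ((KBsym (mkSt (decide (Conn ends x a₂ a₁)) false false false (decide (Conn ends x a₂ o)) (decide (Conn ends x a₂ a₃)) (decide (Conn ends x a₂ a₃))) (mkSt (decide (Conn ends y a₂ a₁)) false false false (decide (Conn ends y a₂ o)) (decide (Conn ends y a₂ a₃)) (decide (Conn ends y a₂ a₃))) (if decide (Conn ends w a₂ a₁) || decide (Conn ends w a₂ a₃) then mkSt true false false false false false false else mkSt false (decide (Conn ends w a₃ o)) true true (decide (Conn ends w a₂ o)) false false) : ℤ) : R) = 0 := by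
      exact_mod_cast hb
    linarith
  rw [hK] at h6
  have h6' : (6 : R) ≠ 0 := by norm_num
  exact (mul_eq_zero.mp h6).resolve_left h6'

/-- **The coincident marking `b = a₃`, a typed root edge `e = {a₁, a₃}` with `a₁` cut off from `o`
and `a₃` when `e` is closed: every typed base vanishes** (both types). -/
theorem typedCount_eq_zero_of_coinc_root_leaf {e : E} (he : ends e = s(a₁, a₃))
    (hiso : ∀ x : Config E, x e = false → ¬ Conn ends x a₁ o ∧ ¬ Conn ends x a₁ a₃)
    (F : Finset E) (heF : e ∈ F) (z : Config E) (τ : E → ℕ) (hτ : ∀ e ∈ F, τ e = 1 ∨ τ e = 2) :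
    typedCount F z τ (K3 ends o a₁ a₂ a₃ a₃ : Config E → Config E → Config E → R) = 0 := by
  rcases hτ e heF with h | h
  · exact typedCount_eq_zero_of_coinc_root_leaf_one ends o a₁ a₂ a₃ he hiso F heF z τ hτ h
  · exact typedCount_eq_zero_of_coinc_root_edge_two ends o a₁ a₂ a₃ he F heF z τ hτ h

/-- The mirror at `a₂`. -/
theorem typedCount_eq_zero_of_coinc_root_leaf' {e : E} (he : ends e = s(a₂, a₃))
    (hiso : ∀ x : Config E, x e = false → ¬ Conn ends x a₂ o ∧ ¬ Conn ends x a₂ a₃)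
    (F : Finset E) (heF : e ∈ F) (z : Config E) (τ : E → ℕ) (hτ : ∀ e ∈ F, τ e = 1 ∨ τ e = 2) :
    typedCount F z τ (K3 ends o a₁ a₂ a₃ a₃ : Config E → Config E → Config E → R) = 0 := by
  rw [← SwapRoots.typedCount_swap_roots ends o a₁ a₂ a₃ a₃ F z τ]
  exact typedCount_eq_zero_of_coinc_root_leaf ends o a₂ a₁ a₃ he hiso F heF z τ hτ

end Main

end CoincRoot

end CovForm

end Summit.Ventures.PercRepro2
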